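import Summits.CriticalPhenomena.SAWScalingLimit.Theses.SAWDefectDecoherence
import Literature.Barriers.CriticalPhenomena.ParafermionicHalfCauchyRiemann
import Literature.Probability.RandomPlanarGeometry.HexParafermionProofs
import HarnessLib

/-!
# `StaggeredSumRule` (route SAWDefectDecoherence, item stmt-CriticalPhenomena-8516)

The exact counter-term of the route's card P1: for a simply connected hexagonal-lattice domain
with vertex set `Λ`, a boundary root `a ∈ ∂Ω` and ANY vertex set `B ⊆ Λ`,

`2·Σ_{black v ∈ B} Σ_{w ∈ B, w ∼ v} (mid{v,w} − c_v) F({v,w})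
   + Σ_{v ∈ B} ε(v) Σ_{w ∼ v, w ∉ B} (mid{v,w} − c_v) F({v,w}) = 0`,

`F = F(a, ·, x_c, 5/8)` the critical parafermionic observable, `ε = +1` on black (up, `v.2 = 0`)
and `−1` on white faces.  It is the sum over `v ∈ B` of `ε(v)·`(vertex relation at `v`)
(Duminil-Copin–Smirnov 2012, Lemma 1, PROVED in the tree:
`DuminilCopinSmirnov2012_lemma1_holds`), rearranged: an interior mid-edge `{v,w} ⊆ B` joins a
black and a white endpoint (`ℍ` is bipartite) and its two contributions satisfy
`(mid − c_w) = −(mid − c_v)`, so with the sign twist they ADD UP to twice the black-rooted term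
(instead of cancelling as in the plain Green identity `HexGreen.sum_relations_eq_hexFlux`);
edges leaving `B` appear once, with the sign of their endpoint in `B`.

Structure: `ssr_staggered_green` is the unconditional bookkeeping identity for an ARBITRARY
function on mid-edges (staggered analogue of `HexGreen.sum_relations_eq_hexFlux`);
`StaggeredSumRule_proof` feeds in Lemma 1 through `lemma1_iff` /
`HexGreen.satisfiesVertexRelations_iff_sum` and converts the neighbour bookkeeping
(`B.filter (adjacent to v)` = `nbrs v ∩ B`, the `finsum` over outside neighbours = the finset sum
over `nbrs v \ B`).
-/

noncomputable section

namespace Summit.CriticalPhenomena.SAWScalingLimit.Theorems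

open Literature.Probability.RandomPlanarGeometry.SAW Literature.Probability.LatticeModels
open Literature.Barriers.CriticalPhenomena Literature.Barriers.CriticalPhenomena.HexGreen
open Literature.Barriers.CriticalPhenomena.HexKernel (term)

/-- Bipartiteness of `ℍ` in colour form: adjacent faces have opposite types, so `v` is an up
face (`v.2 = 0`, "black") iff its neighbour `w` is not. [folklore] -/
theorem ssr_black_iff_of_adj {v w : HexVertex} (h : hexGraph.Adj v w) : v.2 = 0 ↔ ¬ w.2 = 0 := by
  have hne : v.2 ≠ w.2 := fun he => HexKernel.not_hexGraph_adj_of_snd_eq_holds v w he h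
  revert hne
  generalize v.2 = i
  generalize w.2 = j
  revert i j
  decide

/-- The neighbours of `v` inside `B`: filtering `B` by adjacency to `v` is filtering the
three-element neighbour finset `nbrs v` by membership in `B`. [folklore] -/
theorem ssr_filter_adj_eq (B : Finset HexVertex) (v : HexVertex)
    [DecidablePred fun w => hexGraph.Adj v w] :
    B.filter (fun w => hexGraph.Adj v w) = (nbrs v).filter (· ∈ B) := by
  ext w
  simp only [Finset.mem_filter, mem_nbrs_iff]
  exact and_comm

/-- The neighbours of `v` outside `B` form the finite set `nbrs v \ B`, so the `finsum` over
them is a finset sum. [folklore] -/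
theorem ssr_finsum_eq (B : Finset HexVertex) (v : HexVertex) (f : HexVertex → ℂ) :
    ∑ᶠ w ∈ {w : HexVertex | hexGraph.Adj v w ∧ w ∉ B}, f w =
      ∑ w ∈ (nbrs v).filter (· ∉ B), f w := by
  have hset : {w : HexVertex | hexGraph.Adj v w ∧ w ∉ B} = ↑((nbrs v).filter (· ∉ B)) := by
    ext w
    simp [mem_nbrs_iff]
  rw [hset, finsum_mem_coe_finset]

/-- Splitting a sign-twisted sum over `B` into its black (`v.2 = 0`, sign `+1`) and white
(sign `−1`) parts. [folklore] -/
theorem ssr_sum_sign_mul (B : Finset HexVertex) (S : HexVertex → ℂ) :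
    ∑ v ∈ B, (if v.2 = 0 then (1 : ℂ) else -1) * S v =
      ∑ v ∈ B.filter (fun v => v.2 = 0), S v - ∑ v ∈ B.filter (fun v => ¬ v.2 = 0), S v := by
  rw [← Finset.sum_filter_add_sum_filter_not B (fun v => v.2 = 0), sub_eq_add_neg,
    ← Finset.sum_neg_distrib]
  congr 1
  · exact Finset.sum_congr rfl fun v hv => by rw [if_pos (Finset.mem_filter.1 hv).2, one_mul]
  · exact Finset.sum_congr rfl fun v hv => by rw [if_neg (Finset.mem_filter.1 hv).2, neg_one_mul]

/-- **In-`B` contributions rooted at white vertices are minus those rooted at black vertices.**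
An interior mid-edge `{v, w} ⊆ B` joins a black and a white endpoint, and its two contributions
are opposite, `term F v w = -term F w v` (`(mid − c_v) + (mid − c_w) = 0`).
[cite: DuminilCopinSmirnov2012, §3 ("Values at interior mid-edges disappear")] -/
theorem ssr_white_eq_neg_black (B : Finset HexVertex) (F : Sym2 HexVertex → ℂ) :
    ∑ v ∈ B.filter (fun v => ¬ v.2 = 0), ∑ w ∈ (nbrs v).filter (· ∈ B), term F v w =
      -∑ v ∈ B.filter (fun v => v.2 = 0), ∑ w ∈ (nbrs v).filter (· ∈ B), term F v w := by
  classical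
  -- inner sums as sums over `B` with an adjacency indicator
  set g : HexVertex → HexVertex → ℂ := fun v w => if w ∈ nbrs v then term F v w else 0
    with hg_def
  have hrw : ∀ v, ∑ w ∈ (nbrs v).filter (· ∈ B), term F v w = ∑ w ∈ B, g v w := by
    intro v
    rw [Finset.filter_mem_eq_inter, Finset.inter_comm, ← Finset.filter_mem_eq_inter,
      Finset.sum_filter]
  have hg_swap : ∀ v w, g v w = -g w v := by
    intro v w
    by_cases h : w ∈ nbrs v
    · have h' : v ∈ nbrs w := (mem_nbrs_comm v w).1 h
      simp only [hg_def, if_pos h, if_pos h']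
      exact eq_neg_of_add_eq_zero_left (term_add_term_swap F v w)
    · have h' : v ∉ nbrs w := fun h' => h ((mem_nbrs_comm v w).2 h')
      simp only [hg_def, if_neg h, if_neg h', neg_zero]
  have hg_col : ∀ v w, g v w ≠ 0 → (v.2 = 0 ↔ ¬ w.2 = 0) := by
    intro v w hne
    by_cases h : w ∈ nbrs v
    · exact ssr_black_iff_of_adj ((mem_nbrs_iff v w).1 h)
    · exact absurd (by simp only [hg_def, if_neg h]) hne
  simp only [hrw]
  calc ∑ v ∈ B.filter (fun v => ¬ v.2 = 0), ∑ w ∈ B, g v w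
      = ∑ v ∈ B.filter (fun v => ¬ v.2 = 0), ∑ w ∈ B.filter (fun w => w.2 = 0), g v w := by
        refine Finset.sum_congr rfl fun v hv => (Finset.sum_filter_of_ne fun w _ hne => ?_).symm
        by_contra hw
        exact (Finset.mem_filter.1 hv).2 ((hg_col v w hne).2 hw)
    _ = ∑ w ∈ B.filter (fun w => w.2 = 0), ∑ v ∈ B.filter (fun v => ¬ v.2 = 0), g v w :=
        Finset.sum_comm
    _ = ∑ w ∈ B.filter (fun w => w.2 = 0), ∑ v ∈ B, g v w := by
        refine Finset.sum_congr rfl fun w hw => Finset.sum_filter_of_ne fun v _ hne hv => ?_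
        exact (hg_col v w hne).1 hv (Finset.mem_filter.1 hw).2
    _ = ∑ w ∈ B.filter (fun w => w.2 = 0), ∑ v ∈ B, -g w v :=
        Finset.sum_congr rfl fun w _ => Finset.sum_congr rfl fun v _ => hg_swap v w
    _ = -∑ v ∈ B.filter (fun v => v.2 = 0), ∑ w ∈ B, g v w := by
        simp only [Finset.sum_neg_distrib]

/-- **The staggered Green identity** (no relation assumed): for every finite vertex set `B` and
every function `F` on mid-edges, twice the black-rooted in-`B` contributions plus the
sign-twisted contributions of the mid-edges leaving `B` equal the sign-twisted sum over `v ∈ B`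
of the left sides `Σ_{w ∼ v} (mid{v,w} − c_v) F({v,w})` of the vertex relations — the staggered
companion of `HexGreen.sum_relations_eq_hexFlux`, where interior mid-edges double instead of
cancelling. [folklore] -/
theorem ssr_staggered_green (B : Finset HexVertex) (F : Sym2 HexVertex → ℂ) :
    2 * (∑ v ∈ B.filter (fun v => v.2 = 0), ∑ w ∈ (nbrs v).filter (· ∈ B), term F v w) +
        ∑ v ∈ B, (if v.2 = 0 then (1 : ℂ) else -1) *
          ∑ w ∈ (nbrs v).filter (· ∉ B), term F v w =
      ∑ v ∈ B, (if v.2 = 0 then (1 : ℂ) else -1) * ∑ w ∈ nbrs v, term F v w := by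
  have hsplit : ∀ v, ∑ w ∈ nbrs v, term F v w =
      ∑ w ∈ (nbrs v).filter (· ∈ B), term F v w + ∑ w ∈ (nbrs v).filter (· ∉ B), term F v w :=
    fun v => (Finset.sum_filter_add_sum_filter_not (nbrs v) (· ∈ B) (term F v)).symm
  simp only [hsplit, mul_add, Finset.sum_add_distrib, ssr_sum_sign_mul]
  rw [ssr_white_eq_neg_black]
  ring

/-- **`StaggeredSumRule` holds** (item stmt-CriticalPhenomena-8516 of route SAWDefectDecoherence):
for `Λ` simply connected, `a ∈ ∂Ω` and every `B ⊆ Λ`, with `F = F(a, ·, x_c, 5/8)`,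
`2·Σ_{black v ∈ B} Σ_{w ∈ B, w ∼ v} (mid{v,w} − c_v) F({v,w}) + Σ_{v ∈ B} ε(v) Σ_{w ∼ v, w ∉ B}
(mid{v,w} − c_v) F({v,w}) = 0` — the sum of `ε(v)·`(DCS Lemma 1 at `v`) over `v ∈ B`, via the
staggered Green identity `ssr_staggered_green`. [cite: DuminilCopinSmirnov2012, Lemma 1 and Remark 1] -/
theorem StaggeredSumRule_proof :
    Summit.CriticalPhenomena.SAWScalingLimit.Theses.SAWDefectDecoherence.StaggeredSumRule := by
  intro Λ hΛ a ha B hB F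
  -- Lemma 1 at every vertex of `Λ`, as the vanishing of the finset sums over the neighbours
  have hVR : ∀ v ∈ Λ, ∑ w ∈ nbrs v, term F v w = 0 :=
    (satisfiesVertexRelations_iff_sum Λ F).1
      (lemma1_iff.1 DuminilCopinSmirnov2012_lemma1_holds Λ hΛ a ha)
  clear_value F
  have key := ssr_staggered_green B F
  have hzero : ∑ v ∈ B, (if v.2 = 0 then (1 : ℂ) else -1) * ∑ w ∈ nbrs v, term F v w = 0 :=
    Finset.sum_eq_zero fun v hv => by rw [hVR v (hB hv), mul_zero]
  rw [hzero] at key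
  simpa only [ssr_filter_adj_eq, ssr_finsum_eq, term] using key

end Summit.CriticalPhenomena.SAWScalingLimit.Theorems
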